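import Literature.AlgebraicGeometry.Resolution.CohenMacaulayUnmixed
import Literature.AlgebraicGeometry.Resolution.RegularLocalRingsQuotient
import Mathlib.RingTheory.KrullDimension.Regular
import HarnessLib

/-!
# Hypersurface rings over regular local rings are Cohen–Macaulay

Topic `Literature/RingTheory/RegularLocalRing`. For a regular local ring `R` and
`0 ≠ y ∈ 𝔪_R`, the hypersurface ring `R ⧸ (y)` carries an `R ⧸ (y)`-regular sequence in its
maximal ideal of length `dim R ⧸ (y) = dim R - 1` ("un quotient d'un anneau local régulier par
une suite régulière est de Cohen–Macaulay": the depth hypotheses `prof A/tA ≥ 3`, `≥ 4` of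
SGA 2 XI Lemmes 3.16, 3.17 for `A = R` regular, `t = y`, as used in the proof of XI 3.13 (ii);
Matsumura Thm. 17.4 (iii) / 17.8 with Thm. 17.7). Everything is PROVED from the tree's regular
system of parameters (`exists_isRegular_ofList_eq_maximalIdeal`, Matsumura 14.2–14.3) and the
cutting-down lemma (`exists_isRegular_quotSMulTop`, Stacks 00N6); no named facts.

* `exists_isRegular_quotient_span_singleton` — the statement above.

## References

* [Grothendieck1968SGA2] A. Grothendieck, SGA 2, Exp. XI, Lemmes 3.16–3.17 and proof of
  Thm. 3.13 (ii) (arXiv:math/0511279, p. 72: "`A_x` … de profondeur `≥ 4`"; "`dim A ≥ 5`, d'où d)").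
* [Matsumura1987] H. Matsumura, *Commutative Ring Theory*, Thm. 17.4, Thm. 17.8.
* [StacksProject] The Stacks Project, Tag 00N6.
-/

noncomputable section

universe u

namespace Literature.RingTheory.RegularLocalRing

open IsLocalRing RingTheory.Sequence

/-- **A hypersurface ring over a regular local ring is Cohen–Macaulay**: for `R` regular local
and `0 ≠ y ∈ 𝔪_R`, the local ring `R ⧸ (y)` has an `R ⧸ (y)`-regular sequence in its maximal
ideal of length `dim R ⧸ (y)` (`= dim R - 1`). Proof: a regular system of parameters of `R` is an
`R`-regular sequence of length `dim R` (Matsumura 14.3); cutting down by the non-zero-divisor `y`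
(Stacks 00N6) leaves a regular sequence of length `dim R - 1` on `R ⧸ (y)`.
[cite: Matsumura1987, Thm. 17.8 with Thm. 17.4] -/
theorem exists_isRegular_quotient_span_singleton (R : Type u) [CommRing R] [IsRegularLocalRing R]
    {y : R} (hy : y ∈ maximalIdeal R) (hy0 : y ≠ 0) :
    haveI := (Literature.AlgebraicGeometry.Resolution.isLocalRing_quotient_span_singleton hy).2
    ∃ rs : List (R ⧸ Ideal.span {y}), (∀ r ∈ rs, r ∈ maximalIdeal (R ⧸ Ideal.span {y})) ∧
      IsRegular (R ⧸ Ideal.span {y}) rs ∧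
      (rs.length : WithBot ℕ∞) = ringKrullDim (R ⧸ Ideal.span {y}) := by
  haveI := (Literature.AlgebraicGeometry.Resolution.isLocalRing_quotient_span_singleton hy).2
  haveI : IsDomain R := Literature.AlgebraicGeometry.Resolution.isDomain_of_isRegularLocalRing R
  obtain ⟨rs, hreg, hspan, hlen⟩ :=
    Literature.AlgebraicGeometry.Resolution.exists_isRegular_ofList_eq_maximalIdeal R
  have hmem : ∀ r ∈ rs, r ∈ maximalIdeal R := fun r hr =>
    hspan ▸ Ideal.subset_span (by simpa using hr)
  have hyreg : IsSMulRegular R y :=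
    (mem_nonZeroDivisors_of_ne_zero hy0 |> Module.Flat.isSMulRegular_of_nonZeroDivisors)
  obtain ⟨rs', hlen', hmem', hreg'⟩ :=
    Literature.AlgebraicGeometry.Resolution.exists_isRegular_quotSMulTop hreg hmem hyreg hy
  obtain ⟨hmem'', hreg''⟩ :=
    Literature.AlgebraicGeometry.Resolution.isRegular_quotient_of_isRegular_quotSMulTop hy hreg' hmem'
  refine ⟨rs'.map (Ideal.Quotient.mk (Ideal.span {y})), hmem'', hreg'', ?_⟩
  -- lengths: `|rs'| = dim R - 1 = dim R ⧸ (y)`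
  rw [List.length_map, hlen']
  have hdim := ringKrullDim_quotient_span_singleton_succ_eq_ringKrullDim_of_mem_nonZeroDivisors
    (mem_nonZeroDivisors_of_ne_zero hy0) hy
  obtain ⟨m, hm⟩ :=
    Literature.AlgebraicGeometry.Resolution.exists_nat_cast_eq_ringKrullDim (R := R ⧸ Ideal.span {y})
  rw [hm] at hdim ⊢
  rw [← hlen] at hdim
  have h1 : ((m + 1 : ℕ) : WithBot ℕ∞) = ((rs.length : ℕ) : WithBot ℕ∞) := by
    push_cast; exact hdim
  have h2 : m + 1 = rs.length := by exact_mod_cast h1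
  have h3 : rs.length - 1 = m := by omega
  rw [h3]

end Literature.RingTheory.RegularLocalRing

end
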